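import Summits.ResolutionOfSingularities.ResolutionOfSingularities.Theorems.EquisingularLiftEquisingularLiftNatTowerInvTwoPointCentre
import Summits.ResolutionOfSingularities.ResolutionOfSingularities.Theorems.EquisingularLiftEquisingularLiftNatCarrierCutsConeStep
import HarnessLib

/-!
# [OURS · L1 W4.5(b) · EL♮(3)] Rung TOWER₄ — THE LOCALIZED SHADOW TRACE (k-ii-loc) THROUGH A POINT STEP: reading it, transporting it, and the
# clauses (k-iv)/(k-v) of `Tower.Shadow₃` when the cone may meet the centre (tools for …NatTowerInvThreePointCentre; res-D-pv-029 …NatTowerInvDefs v3 p570397)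
# (crux `EquisingularLiftNatThree` = stmt-ResolutionOfSingularities-20148, parent stmt-…-20038; registered stub `stub_elnat_coneTowerPointResolution` @ `ReachTower₄`)

HONEST FRAMING. OURS (cell res-hironaka, crux chain w45b, slot W4.5(b)); NOT a statement of any manuscript; AI-written, weaker than expert
review. Helper `--supports stmt-ResolutionOfSingularities-20148 --as helper`; closes nothing; no `sorry`; standard axioms; DEF-FREE.
res-L1-w45b-stub-4 g8, object (R-a) of res-D-pv-029's retarget list (STATUS 2026-08-27T20:58:53Z / DECISION 20:53:20Z «LOCALIZE THE SHADOW TRACK»,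
after res-type-100's S7 finding 20:46:11Z): the twin of …NatTowerInvTwoPointCentre (p558073) at `Tower.Inv₃`, whose cone-shadow clause (k-ii) is
now only an equality of ideal sheaves RESTRICTED to an open `V ⊇ E`:
  `(k-ii-loc) ∃ V : G.Opens, E ⊆ V ∧ (𝒦.comap jG).comap V.ι = 𝓘⟨closure K⟩.comap V.ι`.

WHAT CHANGES (honestly): with (k-ii) only local, «`jG pt ∉ supp 𝒦`» is no longer derivable for a step point `pt ∉ V ∪ closure K` (the cone may
have components away from the carrier point — exactly res-type-100's finding), so the cone `V(𝒦)` MAY MEET the upstairs centre `C` and the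
off-centre package `fatPointStep_transport … 𝒦` (disjointness, `V(𝒦·𝒪_{X″}) ≅ V(𝒦)`) is unavailable for `𝒦`. Clause by clause for
`𝒦′ := 𝒦·𝒪_{X″}`:
* (k-i) `isPrincipal_stalkIdeal_comap` (pull back a generator);
* (k-ii-loc) on `V′ := υ₂⁻¹V`: `comap_comap_comap_ι_eq_of_loc` — restrict the model square to `V`, use the local trace there, and the DOWNSTAIRS fact
  `𝓘⟨closure K⟩·𝒪_{G′} = 𝓘⟨υ₂⁻¹ closure K⟩ = 𝓘⟨closure υ₂⁻¹(K ∖ pt)⟩` (`IsBlowup.comap_vanishingIdeal_of_disjoint`, `pt ∉ closure K`);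
* (k-iii) flatness and (k-vi) through `V((𝓔 ⊔ 𝒦)·𝒪_{X″}) ≅ V(𝓔 ⊔ 𝒦)` / `V(𝓔·𝒪_{X″}) ≅ V(𝓔)` — these only need `supp 𝓔 ∩ supp C = ∅`, which (e-i)
  (still GLOBAL) and `pt ∉ E` give;
* (k-iv) `Tower.shadow_conditionalRegularity_transport_loc`: a point `y₂` over `supp(𝓔′ ⊔ 𝒦′)` lies over `E ⊆ V`, where the local trace gives
  `υ₂ y₂ ∈ closure K`; the quotient stalks are compared through the stalk isomorphism of `τ` off its centre (no strict transform needed);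
* (k-v) `isEffectiveCartier_comap_comap_subschemeι_of_disjoint_left`: BY LOCALITY on `V(𝒦′)` — off `supp 𝓔′` the divisor is the unit ideal
  (`mem_cartierLocus_of_not_mem_support`), over `supp 𝓔′` the blow-up is a local isomorphism and the Cartier DATUM of …NatCarrierCutsConeStep transports
  (`datum_of_mem_cartierLocus_subschemeι`, `datum_strictTransform_of_not_mem_support`, `mem_cartierLocus_subschemeι_of_datum`).
RESULTS (this file = the tools; the point step itself is …NatTowerInvThreePointCentre): `mem_support_iff_mem_closure_of_comap_ι_eq`,
`comap_comap_comap_ι_eq_of_loc` ((k-ii-loc) transport), `Tower.shadow_conditionalRegularity_transport_loc` ((k-iv)),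
`isEffectiveCartier_comap_comap_subschemeι_of_disjoint_left` ((k-v)).

References: res-D-pv-029 …NatTowerInvDefs v3 p570397; res-L1-w45b-stub-4 …NatTowerInvTwoPointCentre p558073, …NatTowerPtRamInv p555772,
…NatBlowupDisjointTransport p550227, …NatCarrierCutsConeStep p557314; Literature `EffectiveCartierStalks` (Cartier locus), `MonomialMarkedIdealsBlowup`
(`stalkIdeal_strictTransformIdeal_of_not_mem_support`). [cite: GortzWedhorn2020, Prop. 13.91 (3) and (13.19)] [cite: StacksProject, Tags 01WS, 02OS, 033B]
-/

set_option linter.dupNamespace false -- mandated namespace `Summit.<Summit>.<Problem>` of this single-conjunct summit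

noncomputable section

open CategoryTheory CategoryTheory.Limits AlgebraicGeometry TopologicalSpace Topology IsLocalRing
open Literature.AlgebraicGeometry.Resolution
open AlgebraicGeometry.Scheme.IdealSheafData
open Summit.ResolutionOfSingularities.ResolutionOfSingularities.Theses.EquisingularLift.Split
open scoped nonZeroDivisors

namespace Summit.ResolutionOfSingularities.ResolutionOfSingularities.Cruxes.EquisingularLiftNat.Sections

/-! ## Reading and transporting the LOCALIZED trace (k-ii-loc) -/

/-- **Reading a localized trace**: if `(I·𝒪_G)|_V = 𝓘⟨closure K⟩|_V` on an open `V`, then for `x ∈ V`: `jG x ∈ supp I ↔ x ∈ closure K`.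
[folklore] -/
theorem mem_support_iff_mem_closure_of_comap_ι_eq {X G : Scheme.{0}} (jG : G ⟶ X) (I : X.IdealSheafData) (K : Set G) (V : G.Opens)
    (h : (I.comap jG).comap V.ι = (vanishingIdeal (⟨closure K, isClosed_closure⟩ : Closeds G)).comap V.ι) {x : G} (hx : x ∈ V) :
    jG x ∈ (I.support : Set X) ↔ x ∈ closure K := by
  have h1 := congrArg (fun J : Scheme.IdealSheafData V => ((J.support : Closeds V) : Set V)) h
  simp only [support_comap, Closeds.coe_preimage, Scheme.IdealSheafData.coe_support_vanishingIdeal] at h1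
  have h2 := Set.ext_iff.mp h1 ⟨x, hx⟩
  simp only [Set.mem_preimage, Scheme.Opens.ι_apply] at h2
  exact h2

/-- **Transport of the localized trace through a model square over a blow-up centred at one point off `closure K`** (clause (k-ii-loc)
of `Tower.Shadow₃` through a point step): if `j′ ≫ τ = υ ≫ j`, `υ` is the blow-up of `J` with `supp J = {y}`, `y ∉ closure K`, and
`(I·𝒪_G)|_V = 𝓘⟨closure K⟩|_V`, then on `V′ := υ⁻¹V`: `((I·𝒪_{X′})·𝒪_{G′})|_{V′} = 𝓘⟨closure υ⁻¹(K ∖ {y})⟩|_{V′}`.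
[cite: GortzWedhorn2020, Prop. 13.91 (3) and (13.19)] [cite: StacksProject, Tag 033B] [OURS · L1 W4.5b] -/
theorem comap_comap_comap_ι_eq_of_loc {X X' G G' : Scheme.{0}} [IsLocallyNoetherian G] {τ : X' ⟶ X} {j : G ⟶ X} {j' : G' ⟶ X'}
    {υ : G' ⟶ G} (hcomm : j' ≫ τ = υ ≫ j) {J : G.IdealSheafData} (hυ : IsBlowup υ J) {y : G} (hJ : (J.support : Set G) = {y})
    (I : X.IdealSheafData) (K : Set G) (V : G.Opens)
    (hIK : (I.comap j).comap V.ι = (vanishingIdeal (⟨closure K, isClosed_closure⟩ : Closeds G)).comap V.ι) (hyK : y ∉ closure K) :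
    ((I.comap τ).comap j').comap (υ ⁻¹ᵁ V).ι =
      (vanishingIdeal (⟨closure (υ ⁻¹' (K \ {y})), isClosed_closure⟩ : Closeds G')).comap (υ ⁻¹ᵁ V).ι := by
  have hdisj : Disjoint ((⟨closure K, isClosed_closure⟩ : Closeds G) : Set G) (J.support : Set G) := by
    rw [hJ]
    exact Set.disjoint_singleton_right.mpr hyK
  have hpre : (vanishingIdeal (⟨closure K, isClosed_closure⟩ : Closeds G)).comap υ =
      vanishingIdeal (⟨closure (υ ⁻¹' (K \ {y})), isClosed_closure⟩ : Closeds G') := by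
    rw [hυ.comap_vanishingIdeal_of_disjoint _ hdisj]
    congr 1
    apply Closeds.ext
    change υ ⁻¹' closure K = closure (υ ⁻¹' (K \ {y}))
    exact preimage_eq_closure_preimage_diff_of_not_mem hυ hJ K hyK
  calc ((I.comap τ).comap j').comap (υ ⁻¹ᵁ V).ι
      = (I.comap j).comap ((υ ⁻¹ᵁ V).ι ≫ υ) := by
        rw [← Scheme.IdealSheafData.comap_comp, ← Scheme.IdealSheafData.comap_comp, Category.assoc, hcomm,
          ← Category.assoc, Scheme.IdealSheafData.comap_comp]
    _ = ((I.comap j).comap V.ι).comap (υ ∣_ V) := by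
        rw [← morphismRestrict_ι, Scheme.IdealSheafData.comap_comp]
    _ = ((vanishingIdeal (⟨closure K, isClosed_closure⟩ : Closeds G)).comap V.ι).comap (υ ∣_ V) := by rw [hIK]
    _ = ((vanishingIdeal (⟨closure K, isClosed_closure⟩ : Closeds G)).comap υ).comap (υ ⁻¹ᵁ V).ι := by
        rw [← Scheme.IdealSheafData.comap_comp, morphismRestrict_ι, Scheme.IdealSheafData.comap_comp]
    _ = _ := by rw [hpre]

/-! ## (k-iv) through a point step, with the localized trace -/

/-- **Conditional regularity of the pair through a point step off `E` and `closure K`, LOCALIZED TRACE version** of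
`Tower.shadow_conditionalRegularity_transport` (…NatTowerPtRamInv): the cone's trace is only known on an open `V ⊇ E`
(`(𝒦·𝒪_G)|_V = 𝓘⟨closure K⟩|_V`) and the cone may meet the centre; a point `y₂` over `supp(𝓔′ ⊔ 𝒦′)` lies over `E ⊆ V` (by the GLOBAL
trace (e-i) of `𝓔`), where the local trace applies, and the quotient stalks are compared through the stalk isomorphism of `τ` off its centre
(`supp 𝓔 ∩ supp C = ∅`). [cite: GortzWedhorn2020, Prop. 13.91 (3)] [cite: StacksProject, Tag 02OS] [OURS · L1 W4.5b] -/
theorem Tower.shadow_conditionalRegularity_transport_loc {X X'' G G' : Scheme.{0}} [IsLocallyNoetherian X] [IsLocallyNoetherian X'']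
    [IsLocallyNoetherian G] {τ : X'' ⟶ X} {C : X.IdealSheafData} (hτ : IsBlowup τ C) {jG : G ⟶ X} {j₂ : G' ⟶ X''}
    {υ₂ : G' ⟶ G} (hcomm : j₂ ≫ τ = υ₂ ≫ jG) {J : G.IdealSheafData} (hυ₂ : IsBlowup υ₂ J) {pt : G}
    (hJsupp : (J.support : Set G) = {pt}) (𝓔 𝒦 : X.IdealSheafData)
    (hd𝓔 : Disjoint (𝓔.support : Set X) (C.support : Set X))
    {E K : Set G} (hEcl : IsClosed E) (hyE : pt ∉ E) (hyK : pt ∉ closure K)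
    (he1 : 𝓔.comap jG = vanishingIdeal (⟨E, hEcl⟩ : Closeds G)) {V : G.Opens} (hEV : E ⊆ (V : Set G))
    (hk2 : (𝒦.comap jG).comap V.ι = (vanishingIdeal (⟨closure K, isClosed_closure⟩ : Closeds G)).comap V.ι)
    (hk4 : ∀ y : G, jG y ∈ ((𝓔 ⊔ 𝒦).support : Set X) →
      stalkIdeal (vanishingIdeal (⟨E, hEcl⟩ : Closeds G) ⊔ vanishingIdeal (⟨closure K, isClosed_closure⟩ : Closeds G)) y =
        stalkIdeal (vanishingIdeal (⟨E ∩ closure K, hEcl.inter isClosed_closure⟩ : Closeds G)) y →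
      IsRegularLocalRing (X.presheaf.stalk (jG y) ⧸ stalkIdeal (𝓔 ⊔ 𝒦) (jG y)))
    (hE' : IsClosed (closure (υ₂ ⁻¹' (E \ {pt})))) :
    ∀ y₂ : G', j₂ y₂ ∈ ((𝓔.comap τ ⊔ 𝒦.comap τ).support : Set X'') →
      stalkIdeal (vanishingIdeal (⟨closure (υ₂ ⁻¹' (E \ {pt})), hE'⟩ : Closeds G') ⊔
          vanishingIdeal (⟨closure (closure (υ₂ ⁻¹' (K \ {pt}))), isClosed_closure⟩ : Closeds G')) y₂ =
        stalkIdeal (vanishingIdeal (⟨closure (υ₂ ⁻¹' (E \ {pt})) ∩ closure (closure (υ₂ ⁻¹' (K \ {pt}))),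
          hE'.inter isClosed_closure⟩ : Closeds G')) y₂ →
      IsRegularLocalRing (X''.presheaf.stalk (j₂ y₂) ⧸ stalkIdeal (𝓔.comap τ ⊔ 𝒦.comap τ) (j₂ y₂)) := by
  intro y₂ hy₂ hred₂
  -- the point downstairs and its images
  have hτj : τ (j₂ y₂) = jG (υ₂ y₂) := by rw [← Scheme.Hom.comp_apply, hcomm, Scheme.Hom.comp_apply]
  have hmem₁ : jG (υ₂ y₂) ∈ ((𝓔 ⊔ 𝒦).support : Set X) := by
    rw [← Scheme.IdealSheafData.comap_sup, support_comap] at hy₂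
    rw [← hτj]
    exact hy₂
  have hmem𝓔 : jG (υ₂ y₂) ∈ (𝓔.support : Set X) :=
    (Scheme.IdealSheafData.support_antitone (le_sup_left : 𝓔 ≤ 𝓔 ⊔ 𝒦)) hmem₁
  have hmem𝒦 : jG (υ₂ y₂) ∈ (𝒦.support : Set X) :=
    (Scheme.IdealSheafData.support_antitone (le_sup_right : 𝒦 ≤ 𝓔 ⊔ 𝒦)) hmem₁
  have hy₁E : υ₂ y₂ ∈ E := by
    have h1 : υ₂ y₂ ∈ ((𝓔.comap jG).support : Set G) := by rw [support_comap]; exact hmem𝓔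
    rw [he1, Scheme.IdealSheafData.coe_support_vanishingIdeal] at h1
    exact h1
  have hy₁K : υ₂ y₂ ∈ closure K :=
    (mem_support_iff_mem_closure_of_comap_ι_eq jG 𝒦 K V hk2 (hEV hy₁E)).mp hmem𝒦
  have hy₁J : υ₂ y₂ ∉ (J.support : Set G) := by
    rw [hJsupp]
    rintro (h : υ₂ y₂ = pt)
    exact hyK (h ▸ hy₁K)
  have hz : τ (j₂ y₂) ∉ (C.support : Set X) := by
    rw [hτj]
    exact fun h => hd𝓔.le_bot ⟨hmem𝓔, h⟩
  -- the three reduced ideal sheaves of `E`, `closure K`, `E ∩ closure K` pull back to the reduced ones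
  have hEeq : closure (υ₂ ⁻¹' (E \ {pt})) = υ₂ ⁻¹' E := by
    have h := preimage_eq_closure_preimage_diff_of_not_mem hυ₂ hJsupp E (by rwa [hEcl.closure_eq])
    rw [hEcl.closure_eq] at h
    exact h.symm
  have hKeq : closure (closure (υ₂ ⁻¹' (K \ {pt}))) = υ₂ ⁻¹' closure K := by
    rw [closure_closure]
    exact (preimage_eq_closure_preimage_diff_of_not_mem hυ₂ hJsupp K hyK).symm
  have hdE : Disjoint ((⟨E, hEcl⟩ : Closeds G) : Set G) (J.support : Set G) := by
    rw [hJsupp]; exact Set.disjoint_singleton_right.mpr hyE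
  have hdK : Disjoint ((⟨closure K, isClosed_closure⟩ : Closeds G) : Set G) (J.support : Set G) := by
    rw [hJsupp]; exact Set.disjoint_singleton_right.mpr hyK
  have hdEK : Disjoint ((⟨E ∩ closure K, hEcl.inter isClosed_closure⟩ : Closeds G) : Set G) (J.support : Set G) := by
    rw [hJsupp]; exact Set.disjoint_singleton_right.mpr fun h => hyE h.1
  have hIE : vanishingIdeal (⟨closure (υ₂ ⁻¹' (E \ {pt})), hE'⟩ : Closeds G') =
      (vanishingIdeal (⟨E, hEcl⟩ : Closeds G)).comap υ₂ := by
    rw [hυ₂.comap_vanishingIdeal_of_disjoint _ hdE]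
    congr 1
    exact Closeds.ext hEeq
  have hIK : vanishingIdeal (⟨closure (closure (υ₂ ⁻¹' (K \ {pt}))), isClosed_closure⟩ : Closeds G') =
      (vanishingIdeal (⟨closure K, isClosed_closure⟩ : Closeds G)).comap υ₂ := by
    rw [hυ₂.comap_vanishingIdeal_of_disjoint _ hdK]
    congr 1
    exact Closeds.ext hKeq
  have hIEK : vanishingIdeal (⟨closure (υ₂ ⁻¹' (E \ {pt})) ∩ closure (closure (υ₂ ⁻¹' (K \ {pt}))),
      hE'.inter isClosed_closure⟩ : Closeds G') =
      (vanishingIdeal (⟨E ∩ closure K, hEcl.inter isClosed_closure⟩ : Closeds G)).comap υ₂ := by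
    rw [hυ₂.comap_vanishingIdeal_of_disjoint _ hdEK]
    congr 1
    apply Closeds.ext
    change closure (υ₂ ⁻¹' (E \ {pt})) ∩ closure (closure (υ₂ ⁻¹' (K \ {pt}))) = υ₂ ⁻¹' (E ∩ closure K)
    rw [hEeq, hKeq, Set.preimage_inter]
  -- the downstairs reducedness hypothesis descends along the stalk isomorphism of `υ₂` at `y₂`
  haveI : IsIso (υ₂.stalkMap y₂) := hυ₂.isIso_stalkMap_of_not_mem_support hy₁J
  have hbij : Function.Bijective (υ₂.stalkMap y₂).hom := ConcreteCategory.bijective_of_isIso (υ₂.stalkMap y₂)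
  have hred₁ : stalkIdeal (vanishingIdeal (⟨E, hEcl⟩ : Closeds G) ⊔
      vanishingIdeal (⟨closure K, isClosed_closure⟩ : Closeds G)) (υ₂ y₂) =
      stalkIdeal (vanishingIdeal (⟨E ∩ closure K, hEcl.inter isClosed_closure⟩ : Closeds G)) (υ₂ y₂) := by
    rw [hIE, hIK, hIEK, ← Scheme.IdealSheafData.comap_sup, stalkIdeal_comap_eq_map_stalkMap,
      stalkIdeal_comap_eq_map_stalkMap] at hred₂
    have h := congrArg (Ideal.comap (υ₂.stalkMap y₂).hom) hred₂
    rwa [Ideal.comap_map_of_bijective _ hbij, Ideal.comap_map_of_bijective _ hbij] at h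
  -- conditional regularity downstairs at `jG (υ₂ y₂) = τ (j₂ y₂)`, then across the stalk isomorphism of `τ` at `j₂ y₂` (off the centre)
  have hreg₁ := hk4 (υ₂ y₂) hmem₁ hred₁
  rw [← hτj] at hreg₁
  haveI := hreg₁
  haveI : IsIso (τ.stalkMap (j₂ y₂)) := hτ.isIso_stalkMap_of_not_mem_support hz
  let e : X.presheaf.stalk (τ (j₂ y₂)) ≃+* X''.presheaf.stalk (j₂ y₂) := (asIso (τ.stalkMap (j₂ y₂))).commRingCatIsoToRingEquiv
  have hmap : stalkIdeal (𝓔.comap τ ⊔ 𝒦.comap τ) (j₂ y₂) =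
      Ideal.map (e : X.presheaf.stalk (τ (j₂ y₂)) →+* X''.presheaf.stalk (j₂ y₂)) (stalkIdeal (𝓔 ⊔ 𝒦) (τ (j₂ y₂))) := by
    rw [← Scheme.IdealSheafData.comap_sup, stalkIdeal_comap_eq_map_stalkMap]
    rfl
  exact IsRegularLocalRing.of_ringEquiv (Ideal.quotientEquiv _ _ e hmap)

/-! ## (k-v) through a point step: the divisor `E` cuts a Cartier divisor on the transported cone, BY LOCALITY -/

/-- **`𝓔·𝒪_{X″}` cuts an effective Cartier divisor on the transported cone `V(𝒦·𝒪_{X″})`** when `𝓔` does on `V(𝒦)`, `supp 𝓔`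
misses the centre of the blow-up `τ`, and both ideal sheaves have principal stalks: off `supp(𝓔·𝒪_{X″})` the restricted ideal is the unit
ideal; over `supp 𝓔` the blow-up is a local isomorphism and the Cartier DATUM transports (…NatCarrierCutsConeStep). The cone itself may meet
the centre. [cite: StacksProject, Tags 01WS, 02OS] [OURS · L1 W4.5b] -/
theorem isEffectiveCartier_comap_comap_subschemeι_of_disjoint_left {X X'' : Scheme.{0}} [IsLocallyNoetherian X'']
    {τ : X'' ⟶ X} {C : X.IdealSheafData} (hτ : IsBlowup τ C) (𝓔 𝒦 : X.IdealSheafData)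
    (hd𝓔 : Disjoint (𝓔.support : Set X) (C.support : Set X))
    (he2 : ∀ z : X, (stalkIdeal 𝓔 z).IsPrincipal) (hk1 : ∀ z : X, (stalkIdeal 𝒦 z).IsPrincipal)
    (hk5 : IsEffectiveCartier (𝓔.comap 𝒦.subschemeι)) :
    IsEffectiveCartier ((𝓔.comap τ).comap (𝒦.comap τ).subschemeι) := by
  haveI : IsLocallyNoetherian (𝒦.comap τ).subscheme := LocallyOfFiniteType.isLocallyNoetherian (𝒦.comap τ).subschemeι
  rw [isEffectiveCartier_iff_forall_mem_cartierLocus]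
  intro w
  by_cases hz : (𝒦.comap τ).subschemeι w ∈ ((𝓔.comap τ).support : Set X'')
  · -- over `supp 𝓔`: off the centre, transport the datum
    have hz𝓔 : τ ((𝒦.comap τ).subschemeι w) ∈ (𝓔.support : Set X) := by
      rw [support_comap] at hz; exact hz
    have hzC : τ ((𝒦.comap τ).subschemeι w) ∉ (C.support : Set X) := fun h => hd𝓔.le_bot ⟨hz𝓔, h⟩
    have hz𝒦 : τ ((𝒦.comap τ).subschemeι w) ∈ (𝒦.support : Set X) := by
      have h1 : (𝒦.comap τ).subschemeι w ∈ ((𝒦.comap τ).support : Set X'') := by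
        rw [← Scheme.IdealSheafData.range_subschemeι]; exact ⟨w, rfl⟩
      rw [support_comap] at h1; exact h1
    obtain ⟨w₀, hw₀⟩ : τ ((𝒦.comap τ).subschemeι w) ∈ Set.range 𝒦.subschemeι := by
      rw [Scheme.IdealSheafData.range_subschemeι]; exact hz𝒦
    obtain ⟨f, hf⟩ := hk1 (τ ((𝒦.comap τ).subschemeι w))
    obtain ⟨h, hh⟩ := he2 (τ ((𝒦.comap τ).subschemeι w))
    have hf' : stalkIdeal 𝒦 (τ ((𝒦.comap τ).subschemeι w)) = Ideal.span {f} := by rw [hf, Ideal.submodule_span_eq]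
    have hh' : stalkIdeal 𝓔 (τ ((𝒦.comap τ).subschemeι w)) = Ideal.span {h} := by rw [hh, Ideal.submodule_span_eq]
    have hnzd := datum_of_mem_cartierLocus_subschemeι 𝓔 𝒦 w₀ hw₀ (hk5.mem_cartierLocus w₀) f h hf' hh'
    obtain ⟨hK', hE', hnzd'⟩ := datum_strictTransform_of_not_mem_support hτ 𝓔 𝒦 hzC f h hf' hh' hnzd
    have hf'' : stalkIdeal (𝒦.comap τ) ((𝒦.comap τ).subschemeι w) =
        Ideal.span {(τ.stalkMap ((𝒦.comap τ).subschemeι w)).hom f} := by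
      rw [← hK', stalkIdeal_comap_eq_map_stalkMap, stalkIdeal_strictTransformIdeal_of_not_mem_support C 𝒦 hzC]
    have hh'' : stalkIdeal (𝓔.comap τ) ((𝒦.comap τ).subschemeι w) =
        Ideal.span {(τ.stalkMap ((𝒦.comap τ).subschemeι w)).hom h} := by
      rw [← hE', stalkIdeal_comap_eq_map_stalkMap, stalkIdeal_strictTransformIdeal_of_not_mem_support C 𝓔 hzC]
    exact mem_cartierLocus_subschemeι_of_datum (𝓔.comap τ) (𝒦.comap τ) w _ _ hf'' hh'' hnzd'
  · -- off `supp 𝓔`: the unit ideal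
    exact mem_cartierLocus_of_not_mem_support _ (by rw [support_comap]; exact hz)

end Summit.ResolutionOfSingularities.ResolutionOfSingularities.Cruxes.EquisingularLiftNat.Sections

end
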